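import Mathlib
import HarnessLib
import Literature.MathematicalPhysics.StatisticalMechanics.ActivitySpace
import Literature.MathematicalPhysics.StatisticalMechanics.RenormalisationMapZero
import Literature.MathematicalPhysics.StatisticalMechanics.PolymerFactorisationBound
import Literature.MathematicalPhysics.StatisticalMechanics.PolymerProductBound

/-!
# Restriction to connected polymers and multiplicative extension over components
# ([ABKM19] Ch. 6.2: `M(𝓟_k^c)` versus the factorising functionals of `M(𝓟_k)`, Lemma 6.4 (5))

[ABKM19] measure the irrelevant coordinate `K_k` by its values on CONNECTED `k`-polymers
(`‖K‖_k^{(A)}` is a supremum over `𝓟_k^c`, the tree's `WeakNormLE`), while the renormalisation map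
`T_k` ((6.34), `nextKStep`) consumes a functional on ALL `k`-polymers that factorises over connected
components ((6.35), `Factorises`) with `K(∅) = 1`.  The two descriptions are exchanged by

* `restrictConn s K` — `K` on connected `s`-polymers, `0` elsewhere (the coordinate in the additive
  group `activitySpace P k` of the fine-tuning engine);
* `mulExt K` — `X ↦ ∏_{Y ∈ 𝒞(X)} K(Y)`, the multiplicative extension over connected components
  (`mulExt K ∅ = 1`, `mulExt K X = K X` for connected `X`).

Proved here: **`factorises_mulExt`** (Lemma 6.4 (5) shape: `mulExt K` factorises on every scale `s ≥ 1`),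
`mulExt_zero` (`= trivAct = 𝟙_∅`), translation invariance / smoothness / measurability / gauge
locality of `mulExt K` from the same properties of `K` on connected polymers, invariance of the weak
norm under both operations, and **`restrictConn_mem_activitySpace`**.

Everything is proved; no named fact.

## References
* S. Adams, S. Buchholz, R. Kotecký, S. Müller, arXiv:1910.13564, Ch. 6.2 (polymers, `M(𝓟_k)`,
  `M(𝓟_k^c)`, the unit `𝟙_∅`), Lemma 6.4 (5) (6.35), Ch. 6.4 (6.47)–(6.50)
  [AdamsBuchholzKoteckyMuller2019].
-/

noncomputable section

namespace Literature.MathematicalPhysics.StatisticalMechanics.GradientRG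

open scoped BigOperators Classical
open Finset MeasureTheory
open Literature.MathematicalPhysics.StatisticalMechanics.TorusPolymer
  (IsPolymer Separated translate thicken IsLatticeVec isPolymer_translate isConn_translate
    components_translate translate_translate translate_zero translate_inj thicken_mono)
open Literature.Barriers.CriticalPhenomena.LongRangePhi4.Polymer
  (IsConn components components_empty nonempty_of_mem_components subset_of_mem_components
    eq_biUnion_components)
open Literature.MathematicalPhysics.QuantumFieldTheory

variable {d M : ℕ} [NeZero M]

/-! ## Components of a union of separated sets -/

/-! (`TorusPolymer.components_union_of_separated`, ReblockingDecomposition: `𝒞(X₁ ∪ X₂) = 𝒞(X₁) ∪ 𝒞(X₂)`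
for `2`-separated sets, is reused below.) -/

omit [NeZero M] in
/-- The components of `2`-separated sets are disjoint families (a common component would contain a
point of both sets). [cite: AdamsBuchholzKoteckyMuller2019, Ch. 6.2] -/
theorem disjoint_components_of_separated {X₁ X₂ : Finset (Fin d → ZMod M)} (hsep : Separated 2 X₁ X₂) :
    Disjoint (components X₁) (components X₂) := by
  rw [Finset.disjoint_left]
  intro Y hY₁ hY₂
  obtain ⟨y, hy⟩ := nonempty_of_mem_components hY₁
  have h := hsep y (subset_of_mem_components hY₁ hy) y (subset_of_mem_components hY₂ hy)
  rw [sub_self, TorusPolymer.supNorm_zero] at h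
  omega

omit [NeZero M] in
/-- A set with no components is empty. [cite: AdamsBuchholzKoteckyMuller2019, Ch. 6.2] -/
theorem eq_empty_of_components_eq_empty {X : Finset (Fin d → ZMod M)} (h : components X = ∅) : X = ∅ := by
  rw [eq_biUnion_components X, h, biUnion_empty]

/-! ## Restriction to connected polymers -/

/-- **Restriction to connected `s`-polymers**: `K` on connected `s`-polymers, `0` elsewhere (the
coordinate of `K` in `M(𝓟_k^c)`). [cite: AdamsBuchholzKoteckyMuller2019, Ch. 6.2 (M(𝓟_k^c))] -/
def restrictConn {𝔸 : Type*} [Zero 𝔸] (s : ℕ) (K : Finset (Fin d → ZMod M) → ((Fin d → ZMod M) → ℝ) → 𝔸) :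
    Finset (Fin d → ZMod M) → ((Fin d → ZMod M) → ℝ) → 𝔸 :=
  fun X => if IsPolymer s X ∧ IsConn X then K X else 0

section Restrict

variable {s : ℕ} {K K' : Finset (Fin d → ZMod M) → ((Fin d → ZMod M) → ℝ) → ℂ}

/-- On connected polymers the restriction is `K`. [cite: AdamsBuchholzKoteckyMuller2019, Ch. 6.2] -/
theorem restrictConn_of_conn {X : Finset (Fin d → ZMod M)} (hX : IsPolymer s X) (hc : IsConn X) :
    restrictConn s K X = K X := by
  unfold restrictConn; exact if_pos ⟨hX, hc⟩

/-- Off connected polymers the restriction vanishes. [cite: AdamsBuchholzKoteckyMuller2019, Ch. 6.2] -/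
theorem restrictConn_of_not {X : Finset (Fin d → ZMod M)} (hX : ¬ (IsPolymer s X ∧ IsConn X)) :
    restrictConn s K X = 0 := by
  unfold restrictConn; exact if_neg hX

/-- The restriction vanishes at `∅` (the empty set is not connected).
[cite: AdamsBuchholzKoteckyMuller2019, Ch. 6.2] -/
theorem restrictConn_empty : restrictConn s K ∅ = 0 :=
  restrictConn_of_not fun h => Finset.not_nonempty_empty h.2.1

/-- Restriction is additive: `restrictConn (K − K') = restrictConn K − restrictConn K'`.
[cite: AdamsBuchholzKoteckyMuller2019, Ch. 6.2] -/
theorem restrictConn_sub : restrictConn s (K - K') = restrictConn s K - restrictConn s K' := by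
  funext X
  by_cases hX : IsPolymer s X ∧ IsConn X
  · rw [Pi.sub_apply, restrictConn_of_conn hX.1 hX.2, restrictConn_of_conn hX.1 hX.2,
      restrictConn_of_conn hX.1 hX.2, Pi.sub_apply]
  · rw [Pi.sub_apply, restrictConn_of_not hX, restrictConn_of_not hX, restrictConn_of_not hX, sub_zero]

/-- Restriction of `0` is `0`. [cite: AdamsBuchholzKoteckyMuller2019, Ch. 6.2] -/
theorem restrictConn_zero : restrictConn s (0 : Finset (Fin d → ZMod M) → ((Fin d → ZMod M) → ℝ) → ℂ) = 0 := by
  funext X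
  by_cases hX : IsPolymer s X ∧ IsConn X
  · rw [restrictConn_of_conn hX.1 hX.2]
  · rw [restrictConn_of_not hX]; rfl

/-- The restriction is `C^{n}` in the field. [cite: AdamsBuchholzKoteckyMuller2019, Ch. 6.4 (6.47)] -/
theorem contDiff_restrictConn {n : ℕ} (hK : ∀ X, IsPolymer s X → IsConn X → ContDiff ℝ n (K X))
    (X : Finset (Fin d → ZMod M)) : ContDiff ℝ n (restrictConn s K X) := by
  by_cases hX : IsPolymer s X ∧ IsConn X
  · rw [restrictConn_of_conn hX.1 hX.2]; exact hK X hX.1 hX.2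
  · rw [restrictConn_of_not hX]; exact contDiff_const

/-- The restriction is gauge-local on connected polymers.
[cite: AdamsBuchholzKoteckyMuller2019, Ch. 6.4 (6.47)] -/
theorem isGaugeLocal_restrictConn {V : Finset (Fin d → ZMod M) → Type*} [∀ X, NormedAddCommGroup (V X)]
    [∀ X, NormedSpace ℝ (V X)] (T : ∀ X : Finset (Fin d → ZMod M), ((Fin d → ZMod M) → ℝ) →ₗ[ℝ] V X)
    (hK : ∀ X, IsPolymer s X → IsConn X → IsGaugeLocal (T X) (K X))
    {X : Finset (Fin d → ZMod M)} (hX : IsPolymer s X) (hc : IsConn X) :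
    IsGaugeLocal (T X) (restrictConn s K X) := by
  rw [restrictConn_of_conn hX hc]; exact hK X hX hc

/-- The restriction is translation invariant on scale `s` (odd torus `M = s·t`).
[cite: AdamsBuchholzKoteckyMuller2019, Ch. 6.2] -/
theorem transInv_restrictConn {t : ℕ} (hMt : M = s * t) (hs : Odd s) (ht : Odd t) (hK : TransInv s K) :
    TransInv s (restrictConn s K) := by
  intro a ha X φ
  by_cases hX : IsPolymer s X ∧ IsConn X
  · have hX' : IsPolymer s (translate a X) ∧ IsConn (translate a X) :=
      ⟨isPolymer_translate hMt hs ht ha hX.1, isConn_translate hX.2 a⟩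
    rw [restrictConn_of_conn hX'.1 hX'.2, restrictConn_of_conn hX.1 hX.2]
    exact hK a ha X φ
  · have hX' : ¬ (IsPolymer s (translate a X) ∧ IsConn (translate a X)) := by
      intro h'
      apply hX
      have e : translate (-a) (translate a X) = X := by
        rw [translate_translate, add_neg_cancel, translate_zero]
      exact ⟨e ▸ isPolymer_translate hMt hs ht ha.neg h'.1, e ▸ isConn_translate h'.2 (-a)⟩
    rw [restrictConn_of_not hX', restrictConn_of_not hX]
    rfl

/-- The weak norm only reads connected polymers: `‖restrictConn K‖ ≤ C ↔ ‖K‖ ≤ C`.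
[cite: AdamsBuchholzKoteckyMuller2019, Ch. 6.4 (6.50)] -/
theorem weakNormLE_restrictConn_iff {P : NormParams d M} {k : ℕ} {C : ℝ} :
    WeakNormLE P k (restrictConn (P.L ^ k) K) C ↔ WeakNormLE P k K C := by
  constructor
  · intro h X hX hc
    have := h X hX hc
    rwa [restrictConn_of_conn hX hc] at this
  · intro h X hX hc
    rw [restrictConn_of_conn hX hc]
    exact h X hX hc

/-- **The restriction of an admissible functional is an admissible activity** (`C^{r₀}`, local,
translation invariant, of finite weak norm ⇒ member of `activitySpace P k`).
[cite: AdamsBuchholzKoteckyMuller2019, Ch. 6.4 (6.47)–(6.50)] -/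
theorem restrictConn_mem_activitySpace {P : NormParams d M} {k t : ℕ} (hMt : M = P.L ^ k * t)
    (hs : Odd (P.L ^ k)) (ht : Odd t)
    (hd : ∀ X, IsPolymer (P.L ^ k) X → IsConn X → ContDiff ℝ P.r₀ (K X))
    (hl : ∀ X, IsPolymer (P.L ^ k) X → IsConn X → IsGaugeLocal (P.gauge k X) (K X))
    (hK : TransInv (P.L ^ k) K) {C : ℝ} (hC : WeakNormLE P k K C) :
    restrictConn (P.L ^ k) K ∈ activitySpace P k :=
  activitySpace.mem_of (contDiff_restrictConn hd) (fun _ hX hc => isGaugeLocal_restrictConn (P.gauge k) hl hX hc)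
    (transInv_restrictConn hMt hs ht hK) (weakNormLE_restrictConn_iff.2 hC)

end Restrict

/-! ## Multiplicative extension over components -/

/-- **Multiplicative extension over connected components**: `mulExt K X = ∏_{Y ∈ 𝒞(X)} K(Y)`
(the factorising functional of `M(𝓟_k)` determined by an element of `M(𝓟_k^c)`; `= 1` at `∅`).
[cite: AdamsBuchholzKoteckyMuller2019, Ch. 6.2 (6.35)] -/
def mulExt (K : Finset (Fin d → ZMod M) → ((Fin d → ZMod M) → ℝ) → ℂ) :
    Finset (Fin d → ZMod M) → ((Fin d → ZMod M) → ℝ) → ℂ :=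
  fun X φ => ∏ Y ∈ components X, K Y φ

section MulExt

variable {K K' : Finset (Fin d → ZMod M) → ((Fin d → ZMod M) → ℝ) → ℂ}

omit [NeZero M] in
/-- Unfolding. [cite: AdamsBuchholzKoteckyMuller2019, Ch. 6.2 (6.35)] -/
theorem mulExt_apply (X : Finset (Fin d → ZMod M)) (φ : (Fin d → ZMod M) → ℝ) :
    mulExt K X φ = ∏ Y ∈ components X, K Y φ := rfl

omit [NeZero M] in
/-- `mulExt K ∅ = 1`. [cite: AdamsBuchholzKoteckyMuller2019, Ch. 6.2 (K(∅) = 1)] -/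
@[simp] theorem mulExt_empty (φ : (Fin d → ZMod M) → ℝ) : mulExt K ∅ φ = 1 := by
  rw [mulExt_apply, components_empty, prod_empty]

omit [NeZero M] in
/-- On connected sets the extension is `K`. [cite: AdamsBuchholzKoteckyMuller2019, Ch. 6.2] -/
theorem mulExt_of_isConn {X : Finset (Fin d → ZMod M)} (hc : IsConn X) : mulExt K X = K X := by
  funext φ
  rw [mulExt_apply, hc.components_eq, prod_singleton]

/-- The extension of the restriction is `K` on connected polymers.
[cite: AdamsBuchholzKoteckyMuller2019, Ch. 6.2] -/
theorem mulExt_restrictConn_of_conn {s : ℕ} {X : Finset (Fin d → ZMod M)} (hX : IsPolymer s X)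
    (hc : IsConn X) : mulExt (restrictConn s K) X = K X := by
  rw [mulExt_of_isConn hc, restrictConn_of_conn hX hc]

/-- **`mulExt K` factorises on every scale `s ≥ 1`** ([ABKM19] (6.35)): for `(s+1)`-separated sets
the components of the union are the disjoint union of the components.
[cite: AdamsBuchholzKoteckyMuller2019, Lemma 6.4 (5) (6.35)] -/
theorem factorises_mulExt {s : ℕ} (hs : 1 ≤ s) : Factorises s (mulExt K) := by
  intro X₁ X₂ _ _ hsep φ
  have hsep2 : Separated 2 X₁ X₂ := hsep.of_le (by omega)
  rw [mulExt_apply, mulExt_apply, mulExt_apply, TorusPolymer.components_union_of_separated hsep2,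
    prod_union (disjoint_components_of_separated hsep2)]

omit [NeZero M] in
/-- `mulExt 0 = 𝟙_∅` (the origin of the flow). [cite: AdamsBuchholzKoteckyMuller2019, Ch. 6.2 (the unit 𝟙_∅)] -/
theorem mulExt_zero : mulExt (0 : Finset (Fin d → ZMod M) → ((Fin d → ZMod M) → ℝ) → ℂ) = trivAct := by
  funext X φ
  rw [mulExt_apply, trivAct_apply]
  by_cases hX : X = ∅
  · subst hX
    rw [components_empty, prod_empty, TorusPolymer.punit_empty]
  · have hne : (components X).Nonempty := by
      rw [Finset.nonempty_iff_ne_empty]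
      exact fun h => hX (eq_empty_of_components_eq_empty h)
    obtain ⟨Y, hY⟩ := hne
    rw [prod_eq_zero hY (by rfl)]
    unfold TorusPolymer.punit
    rw [if_neg hX]

/-- The extension is `C^{n}` in the field when `K` is. [cite: AdamsBuchholzKoteckyMuller2019, Ch. 6.4 (6.47)] -/
theorem contDiff_mulExt {n : ℕ} (hK : ∀ Y, ContDiff ℝ n (K Y)) (X : Finset (Fin d → ZMod M)) :
    ContDiff ℝ n (mulExt K X) :=
  contDiff_prod fun Y _ => hK Y

omit [NeZero M] in
/-- The extension is measurable in the field when `K` is. [cite: AdamsBuchholzKoteckyMuller2019, Ch. 6.2] -/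
theorem measurable_mulExt (hK : ∀ Y, Measurable (K Y)) (X : Finset (Fin d → ZMod M)) :
    Measurable (mulExt K X) :=
  Finset.measurable_prod _ fun Y _ => hK Y

omit [NeZero M] in
/-- **Translation invariance**: components translate, so `mulExt K` is translation invariant on scale
`s` when `K` is. [cite: AdamsBuchholzKoteckyMuller2019, Lemma 6.4 (1)] -/
theorem transInv_mulExt {s : ℕ} (hK : TransInv s K) : TransInv s (mulExt K) := by
  intro a ha X φ
  rw [mulExt_apply, mulExt_apply, components_translate,
    prod_image fun Y _ Z _ h => translate_inj h]
  exact prod_congr rfl fun Y _ => hK a ha Y φ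

/-- **Gauge locality on every polymer**: each factor `K(Z)`, `Z ∈ 𝒞(X)`, is local for the gauge of
`Z* ⊆ X*` (odd torus, odd `s`). [cite: AdamsBuchholzKoteckyMuller2019, Lemma 6.4 (2)–(3)] -/
theorem isGaugeLocal_mulExt (hM : Odd M) {s : ℕ} (hs : Odd s) {𝔥 Rg : ℝ} {p rad : ℕ}
    (hKloc : ∀ Y, IsPolymer s Y → IsConn Y → IsGaugeLocal (fieldGauge 𝔥 Rg p (thicken rad Y)) (K Y))
    {X : Finset (Fin d → ZMod M)} (hX : IsPolymer s X) :
    IsGaugeLocal (fieldGauge 𝔥 Rg p (thicken rad X)) (mulExt K X) := by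
  refine IsGaugeLocal.prod _ fun Z hZ => ?_
  obtain ⟨hZp, hZc⟩ := TorusPolymer.IsPolymer.of_mem_components hM hs hX hZ
  exact (hKloc Z hZp hZc).of_norm_le fun ξ =>
    norm_fieldGauge_mono_set _ _ _ (thicken_mono _ (subset_of_mem_components hZ)) ξ

/-- Locality of `mulExt K` on connected polymers for any family of gauges (it is `K` there).
[cite: AdamsBuchholzKoteckyMuller2019, Ch. 6.4 (6.47)] -/
theorem isGaugeLocal_mulExt_conn {V : Finset (Fin d → ZMod M) → Type*} [∀ X, NormedAddCommGroup (V X)]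
    [∀ X, NormedSpace ℝ (V X)] {s : ℕ} (T : ∀ X : Finset (Fin d → ZMod M), ((Fin d → ZMod M) → ℝ) →ₗ[ℝ] V X)
    (hK : ∀ X, IsPolymer s X → IsConn X → IsGaugeLocal (T X) (K X))
    {X : Finset (Fin d → ZMod M)} (hX : IsPolymer s X) (hc : IsConn X) :
    IsGaugeLocal (T X) (mulExt K X) := by
  rw [mulExt_of_isConn hc]; exact hK X hX hc

/-- **The weak norm of the extension is that of `K`** (the norm only reads connected polymers).
[cite: AdamsBuchholzKoteckyMuller2019, Ch. 6.4 (6.50)] -/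
theorem weakNormLE_mulExt_iff {P : NormParams d M} {k : ℕ} {C : ℝ} :
    WeakNormLE P k (mulExt K) C ↔ WeakNormLE P k K C := by
  constructor
  · intro h X hX hc
    have := h X hX hc
    rwa [mulExt_of_isConn hc] at this
  · intro h X hX hc
    rw [mulExt_of_isConn hc]
    exact h X hX hc

/-- Differences of extensions agree with the difference on connected polymers, hence have the
same weak norm. [cite: AdamsBuchholzKoteckyMuller2019, Ch. 6.4 (6.50)] -/
theorem weakNormLE_mulExt_sub_iff {P : NormParams d M} {k : ℕ} {C : ℝ} :
    WeakNormLE P k (mulExt K - mulExt K') C ↔ WeakNormLE P k (K - K') C := by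
  constructor
  · intro h X hX hc
    have := h X hX hc
    rwa [Pi.sub_apply, mulExt_of_isConn hc, mulExt_of_isConn hc, ← Pi.sub_apply] at this
  · intro h X hX hc
    rw [Pi.sub_apply, mulExt_of_isConn hc, mulExt_of_isConn hc, ← Pi.sub_apply]
    exact h X hX hc

end MulExt

/-! ## The extension of an admissible activity -/

namespace activitySpace

variable {P : NormParams d M} {k : ℕ}

/-- The extension of an admissible activity is `C^{r₀}` on every set.
[cite: AdamsBuchholzKoteckyMuller2019, Ch. 6.4 (6.47)] -/
theorem contDiff_mulExt (K : activitySpace P k) (X : Finset (Fin d → ZMod M)) :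
    ContDiff ℝ P.r₀ (mulExt (K : Finset (Fin d → ZMod M) → ((Fin d → ZMod M) → ℝ) → ℂ) X) :=
  GradientRG.contDiff_mulExt (activitySpace.contDiff K) X

/-- The extension of an admissible activity is measurable on every set.
[cite: AdamsBuchholzKoteckyMuller2019, Ch. 6.2] -/
theorem measurable_mulExt (K : activitySpace P k) (X : Finset (Fin d → ZMod M)) :
    Measurable (mulExt (K : Finset (Fin d → ZMod M) → ((Fin d → ZMod M) → ℝ) → ℂ) X) :=
  GradientRG.measurable_mulExt (fun Y => (activitySpace.contDiff K Y).continuous.measurable) X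

/-- The extension of an admissible activity is translation invariant on scale `k`.
[cite: AdamsBuchholzKoteckyMuller2019, Lemma 6.4 (1)] -/
theorem transInv_mulExt (K : activitySpace P k) :
    TransInv (P.L ^ k) (mulExt (K : Finset (Fin d → ZMod M) → ((Fin d → ZMod M) → ℝ) → ℂ)) :=
  GradientRG.transInv_mulExt (activitySpace.transInv K)

/-- The extension of an admissible activity is local on connected `k`-polymers.
[cite: AdamsBuchholzKoteckyMuller2019, Ch. 6.4 (6.47)] -/
theorem isGaugeLocal_mulExt (K : activitySpace P k) {X : Finset (Fin d → ZMod M)}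
    (hX : IsPolymer (P.L ^ k) X) (hc : IsConn X) :
    IsGaugeLocal (P.gauge k X) (mulExt (K : Finset (Fin d → ZMod M) → ((Fin d → ZMod M) → ℝ) → ℂ) X) :=
  isGaugeLocal_mulExt_conn (P.gauge k) (fun _ hY hYc => activitySpace.isGaugeLocal K hY hYc) hX hc

/-- The weak norm of the extension is that of the activity.
[cite: AdamsBuchholzKoteckyMuller2019, Ch. 6.4 (6.50)] -/
theorem weakNormLE_mulExt (K : activitySpace P k) {C : ℝ} (hC : activityNormLE P k K C) :
    WeakNormLE P k (mulExt (K : Finset (Fin d → ZMod M) → ((Fin d → ZMod M) → ℝ) → ℂ)) C :=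
  weakNormLE_mulExt_iff.2 hC

/-- The weak norm of a difference of extensions is that of the difference of the activities.
[cite: AdamsBuchholzKoteckyMuller2019, Ch. 6.4 (6.50)] -/
theorem weakNormLE_mulExt_sub (K K' : activitySpace P k) {C : ℝ} (hC : activityNormLE P k (K - K') C) :
    WeakNormLE P k (mulExt (K : Finset (Fin d → ZMod M) → ((Fin d → ZMod M) → ℝ) → ℂ) -
      mulExt (K' : Finset (Fin d → ZMod M) → ((Fin d → ZMod M) → ℝ) → ℂ)) C :=
  weakNormLE_mulExt_sub_iff.2 (by
    have : ((K - K' : activitySpace P k) : Finset (Fin d → ZMod M) → ((Fin d → ZMod M) → ℝ) → ℂ) =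
        (K : Finset (Fin d → ZMod M) → ((Fin d → ZMod M) → ℝ) → ℂ) - K' := Submodule.coe_sub _ K K'
    rw [← this]; exact hC)

end activitySpace

end Literature.MathematicalPhysics.StatisticalMechanics.GradientRG

end
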